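import Literature.NumberTheory.NumberFields.CubicField14483
import Literature.NumberTheory.NumberFields.CubicFieldResiduePrimes
import Literature.NumberTheory.NumberFields.CubicFieldOneRealPlace
import Literature.Topology.FourManifolds.CappellShanesonClassNumberTwoUnits
import HarnessLib

/-!
# The cubic field of discriminant `-14483`, III: one real place, unit rank one, and
# `𝓞ˣ = ⟨-1, ε⟩ · (𝓞ˣ)²`, `ε = -15 - γ + 2δ`

Third file on the `2`-division field `K = ℚ(γ)` of `E_{28/9}` (`CubicField14483.lean`). Since `Δ(f) < 0` the field has
exactly one real place (Cohen §4.1.3; tree `nrRealPlaces_eq_one_of_cubic_discr_neg`), so the unit rank is `1`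
(Dirichlet, Marcus Ch. 5 Thm. 38) and `𝓞ˣ/(𝓞ˣ)²` has at most `4` elements. The four units `±1, ±ε` have pairwise
different quadratic-residue SIGNATURES at the degree-one primes `(5, γ - 3)` and `(19, γ - 15)` (Euler's criterion:
`ψ₅(ε) = 3`, a non-residue mod `5`; `ψ₁₉(ε) = 8`, `8⁹ ≡ -1 (mod 19)`; `-1` is a residue mod `5` and not mod `19`),
hence — with no regulator and no fundamental-unit computation — **every unit of `K` is `± ε^i η²`**
(`unit_eq_rep_mul_sq`), and a unit with trivial signature is a square (`isSquare_of_signature_eq_one`).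
This is the unit input of `K(S, 2)` for the `2`-descent over `K` (Silverman AEC X.1.1).
Pattern of the tree's `RankNotSumOfLocalInvariantsF3CubicK13Units.lean` (rank `2`). Everything is proved;
theorems only.

## References
* [Marcus2018] D. A. Marcus, *Number Fields*, 2nd ed. (2018), Ch. 5, Thm. 38 (Dirichlet's unit theorem).
* [Cohen1993] H. Cohen, *A Course in Computational Algebraic Number Theory*, §4.1.3 (signature of a cubic field).
-/

noncomputable section

open Polynomial Module NumberField Ideal
open scoped NumberField

namespace Literature.NumberTheory.NumberFields

namespace CubicField14483

open MonicCubic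
open Literature.Topology.FourManifolds (ringHom_units_ne_zero exists_rep_mul_sq)

variable {K : Type*} [Field K] [NumberField K] {γ : K}

/-! ### One real place, unit rank one -/

/-- **`K` has exactly one real place** (`Δ(f) = -130347 < 0`). [cite: Cohen1993, §4.1.3] -/
theorem nrRealPlaces_eq_one (hγ : γ ^ 3 - γ ^ 2 + 27 * γ + 36 = 0) (h3 : finrank ℚ K = 3) :
    InfinitePlace.nrRealPlaces K = 1 := by
  refine nrRealPlaces_eq_one_of_cubic_discr_neg (pb irreducible_polyQ (aeval_eq hγ) h3) h3
    (P := ⟨1, -1, 27, 36⟩) (by norm_num) (by norm_num [Cubic.discr]) ?_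
  rw [pb_gen]
  simp only [Cubic.toPoly, map_add, map_mul, map_pow, aeval_X, aeval_C, map_one, one_mul, map_neg,
    eq_ratCast]
  push_cast
  linear_combination hγ

/-- `K` has exactly one complex place. [cite: Cohen1993, §4.1.3] -/
theorem nrComplexPlaces_eq_one (hγ : γ ^ 3 - γ ^ 2 + 27 * γ + 36 = 0) (h3 : finrank ℚ K = 3) :
    InfinitePlace.nrComplexPlaces K = 1 := by
  have h := InfinitePlace.card_add_two_mul_card_eq_rank K
  rw [nrRealPlaces_eq_one hγ h3, h3] at h
  omega

/-- **The unit rank of `K` is `1`** (Dirichlet: `r₁ + r₂ - 1 = 1 + 1 - 1`). [cite: Marcus2018, Ch. 5, Thm. 38] -/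
theorem units_rank_eq_one (hγ : γ ^ 3 - γ ^ 2 + 27 * γ + 36 = 0) (h3 : finrank ℚ K = 3) :
    NumberField.Units.rank K = 1 := by
  rw [NumberField.Units.rank, InfinitePlace.card_eq_nrRealPlaces_add_nrComplexPlaces,
    nrRealPlaces_eq_one hγ h3, nrComplexPlaces_eq_one hγ h3]

/-! ### The signature at `(5, γ - 3)` and `(19, γ - 15)`; units modulo squares -/

/-- The residue maps used for the signature: `ψ₅ : γ ↦ 3, δ ↦ 3` and `ψ₁₉ : γ ↦ 15, δ ↦ 0`.
[cite: Marcus2018, Ch. 3, Thm. 27] -/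
theorem exists_signatureHoms (hγ : γ ^ 3 - γ ^ 2 + 27 * γ + 36 = 0) (h3 : finrank ℚ K = 3) :
    (∃ ψ : 𝓞 K →+* ZMod 5, ψ (thetaInt (aeval_eq hγ)) = 3 ∧ ψ (thetaInt (delta_root hγ)) = 3) ∧
    (∃ ψ : 𝓞 K →+* ZMod 19, ψ (thetaInt (aeval_eq hγ)) = 15 ∧ ψ (thetaInt (delta_root hγ)) = 0) := by
  -- finite facts, decided before any local instance is in scope
  have r5 : ((3 : ℤ) : ZMod 5) ^ 3 + ((-1 : ℤ) : ZMod 5) * ((3 : ℤ) : ZMod 5) ^ 2 + ((27 : ℤ) : ZMod 5) * (3 : ℤ) +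
      ((36 : ℤ) : ZMod 5) = 0 := by decide
  have d5 : ∀ d : ZMod 5, 3 * d = ((3 : ℤ) : ZMod 5) ^ 2 - ((3 : ℤ) : ZMod 5) + 18 → d = 3 := by decide
  have r19 : ((15 : ℤ) : ZMod 19) ^ 3 + ((-1 : ℤ) : ZMod 19) * ((15 : ℤ) : ZMod 19) ^ 2 +
      ((27 : ℤ) : ZMod 19) * (15 : ℤ) + ((36 : ℤ) : ZMod 19) = 0 := by decide
  have d19 : ∀ d : ZMod 19, 3 * d = ((15 : ℤ) : ZMod 19) ^ 2 - ((15 : ℤ) : ZMod 19) + 18 → d = 0 := by decide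
  have c3 : (((3 : ℤ) : ZMod 5) : ZMod 5) = 3 := by decide
  have c15 : (((15 : ℤ) : ZMod 19) : ZMod 19) = 15 := by decide
  haveI : Fact (Nat.Prime 5) := ⟨by norm_num⟩
  haveI : Fact (Nat.Prime 19) := ⟨by norm_num⟩
  constructor
  · obtain ⟨ψ, h1, h2⟩ := exists_residueHom_gamma' hγ h3 (p := 5) (by norm_num) 3 r5
    exact ⟨ψ, by rw [h1, c3], d5 _ h2⟩
  · obtain ⟨ψ, h1, h2⟩ := exists_residueHom_gamma' hγ h3 (p := 19) (by norm_num) 15 r19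
    exact ⟨ψ, by rw [h1, c15], d19 _ h2⟩
where
  /-- (local restatement of `CubicField14483Primes.exists_residueHom_gamma`, to keep this file independent of
  the primes file) [cite: Marcus2018, Ch. 3, Thm. 27] -/
  exists_residueHom_gamma' (hγ : γ ^ 3 - γ ^ 2 + 27 * γ + 36 = 0) (h3 : finrank ℚ K = 3)
      {p : ℕ} [hp : Fact p.Prime] (hp3 : p ≠ 3) (r : ℤ)
      (hr : (r : ZMod p) ^ 3 + ((-1 : ℤ) : ZMod p) * (r : ZMod p) ^ 2 + ((27 : ℤ) : ZMod p) * r +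
        ((36 : ℤ) : ZMod p) = 0) :
      ∃ ψ : 𝓞 K →+* ZMod p, ψ (thetaInt (aeval_eq hγ)) = r ∧
        3 * ψ (thetaInt (delta_root hγ)) = (r : ZMod p) ^ 2 - r + 18 := by
    have hpN : ¬ p ∣ 3 := fun h => hp3 ((Nat.prime_dvd_prime_iff_eq hp.out Nat.prime_three).mp h)
    obtain ⟨ψ, hψ⟩ := MonicCubic.exists_residueHom irreducible_polyQ (aeval_eq hγ) h3 (mem3 hγ h3) hpN r hr
    refine ⟨ψ, hψ, ?_⟩
    have h := congrArg ψ (three_delta hγ)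
    rw [map_mul, map_ofNat, map_add, map_sub, map_pow, map_ofNat, hψ] at h
    exact h

/-- **Every unit of `K` is `± ε^i · η²`** (`ε = -15 - γ + 2δ`; Dirichlet gives at most `4` classes in
`𝓞ˣ/(𝓞ˣ)²`, and `±1, ±ε` have the four different signatures `(ψ₅(·)², ψ₁₉(·)⁹) ∈ {±1}²`, so they represent
all classes). [cite: Marcus2018, Ch. 5, Thm. 38] -/
theorem unit_eq_rep_mul_sq (hγ : γ ^ 3 - γ ^ 2 + 27 * γ + 36 = 0) (h3 : finrank ℚ K = 3) (x : (𝓞 K)ˣ) :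
    ∃ (s i : Fin 2) (η : (𝓞 K)ˣ),
      x = (-1) ^ (s : ℕ) *
        Units.mkOfMulEqOne (-15 - thetaInt (aeval_eq hγ) + 2 * thetaInt (delta_root hγ))
          (183 - 19 * thetaInt (aeval_eq hγ) + 47 * thetaInt (delta_root hγ)) (eps_mul_inv hγ) ^ (i : ℕ) *
        η ^ 2 := by
  classical
  haveI : Fact (1 < 5) := ⟨by norm_num⟩
  haveI : Fact (1 < 19) := ⟨by norm_num⟩
  obtain ⟨⟨ψ₅, h₅γ, h₅δ⟩, ⟨ψ₁₉, h₁₉γ, h₁₉δ⟩⟩ := exists_signatureHoms hγ h3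
  set εU : (𝓞 K)ˣ := Units.mkOfMulEqOne (-15 - thetaInt (aeval_eq hγ) + 2 * thetaInt (delta_root hγ))
    (183 - 19 * thetaInt (aeval_eq hγ) + 47 * thetaInt (delta_root hγ)) (eps_mul_inv hγ) with hεU
  -- the signature (Euler's criterion at `5` and `19`)
  let σ : (𝓞 K)ˣ → ZMod 5 × ZMod 19 := fun y => (ψ₅ (y : 𝓞 K) ^ 2, ψ₁₉ (y : 𝓞 K) ^ 9)
  have hσmul : ∀ y z, σ (y * z) = σ y * σ z := by
    intro y z
    simp only [σ, Units.val_mul, map_mul, mul_pow, Prod.mk_mul_mk]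
  have hσsq : ∀ η, σ (η ^ 2) = 1 := by
    intro η
    have h5' : ∀ u : ZMod 5, u ≠ 0 → (u ^ 2) ^ 2 = 1 := by decide
    have h19' : ∀ u : ZMod 19, u ≠ 0 → (u ^ 2) ^ 9 = 1 := by decide
    simp only [σ, Units.val_pow_eq_pow_val, map_pow]
    rw [h5' _ (ringHom_units_ne_zero ψ₅ η), h19' _ (ringHom_units_ne_zero ψ₁₉ η)]
    rfl
  have hσε : σ εU = (4, 18) := by
    simp only [σ, hεU, Units.val_mkOfMulEqOne, map_add, map_sub, map_neg, map_mul, map_ofNat, h₅γ, h₅δ,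
      h₁₉γ, h₁₉δ]
    decide
  have hσn : σ (-1) = (1, 18) := by
    simp only [σ, Units.val_neg, Units.val_one, map_neg, map_one]
    decide
  -- Dirichlet: every unit is `ρ(e) η²`, `e` in a set of `≤ 4` exponent vectors
  set F := NumberField.Units.fundSystem K with hF
  let E := Fin 2 × (Fin (NumberField.Units.rank K) → Fin 2)
  let ρ : E → (𝓞 K)ˣ := fun e => (-1) ^ (e.1 : ℕ) * ∏ j, F j ^ ((e.2 j : ℕ))
  have hcardE : Fintype.card E = 4 := by
    simp only [E, Fintype.card_prod, Fintype.card_fun, Fintype.card_fin, units_rank_eq_one hγ h3]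
    norm_num
  have hred : ∀ y : (𝓞 K)ˣ, ∃ e : E, σ y = σ (ρ e) := by
    intro y
    obtain ⟨s, e, η, hy⟩ := exists_rep_mul_sq h3 y
    exact ⟨(s, e), by rw [hy, hσmul, hσsq, mul_one]⟩
  -- the four signatures are realised by `±1, ±ε`
  let T : Finset (ZMod 5 × ZMod 19) := {(1, 1), (1, 18), (4, 18), (4, 1)}
  have hTcard : T.card = 4 := by decide
  have hsurjT : T ⊆ Finset.univ.image (σ ∘ ρ) := by
    intro v hv
    rw [Finset.mem_image]
    have hreal : ∃ y : (𝓞 K)ˣ, σ y = v := by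
      simp only [T, Finset.mem_insert, Finset.mem_singleton] at hv
      rcases hv with rfl | rfl | rfl | rfl
      · exact ⟨1, by simp [σ]⟩
      · exact ⟨-1, hσn⟩
      · exact ⟨εU, hσε⟩
      · exact ⟨-1 * εU, by rw [hσmul, hσn, hσε]; decide⟩
    obtain ⟨y, hy⟩ := hreal
    obtain ⟨e, he⟩ := hred y
    exact ⟨e, Finset.mem_univ e, by rw [Function.comp_apply, ← he, hy]⟩
  have hinj : Set.InjOn (σ ∘ ρ) (Finset.univ : Finset E) := by
    rw [← Finset.card_image_iff]
    apply le_antisymm Finset.card_image_le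
    calc (Finset.univ : Finset E).card = Fintype.card E := Finset.card_univ
      _ = 4 := hcardE
      _ = T.card := hTcard.symm
      _ ≤ (Finset.univ.image (σ ∘ ρ)).card := Finset.card_le_card hsurjT
  -- the class of `x` is one of `±ε^i`
  obtain ⟨s, e, η, hxe⟩ := exists_rep_mul_sq h3 x
  have hσx : σ x = σ (ρ (s, e)) := by rw [hxe, hσmul, hσsq, mul_one]
  -- find `(s', i)` with `σ(±ε^i) = σ x`; then `ρ(s,e)` and `(-1)^s' ε^i` differ by a square: both are `ρ`-values?
  -- Simpler: `σ x ∈ T`, realised by `u ∈ {1, -1, εU, -εU}`; `x u⁻¹` has trivial signature, hence is a square.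
  have hxT : σ x ∈ Finset.univ.image (σ ∘ ρ) := Finset.mem_image.mpr ⟨(s, e), Finset.mem_univ _, hσx.symm⟩
  have himgT : Finset.univ.image (σ ∘ ρ) = T := by
    refine (Finset.eq_of_subset_of_card_le hsurjT ?_).symm
    calc (Finset.univ.image (σ ∘ ρ)).card ≤ (Finset.univ : Finset E).card := Finset.card_image_le
      _ = 4 := by rw [Finset.card_univ, hcardE]
      _ = T.card := hTcard.symm
  rw [himgT] at hxT
  -- a unit of trivial signature is a square
  have hsq : ∀ y : (𝓞 K)ˣ, σ y = 1 → ∃ η' : (𝓞 K)ˣ, y = η' ^ 2 := by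
    intro y hy
    obtain ⟨s', e', η', hye⟩ := exists_rep_mul_sq h3 y
    have h1 : σ (ρ (s', e')) = σ (ρ (0, fun _ => 0)) := by
      have hρ0 : ρ (0, fun _ => 0) = 1 := by simp [ρ]
      rw [hρ0]
      have : σ y = σ (ρ (s', e')) := by rw [hye, hσmul, hσsq, mul_one]
      rw [← this, hy]
      simp only [σ, Units.val_one, map_one, one_pow]
      rfl
    have he0 : (s', e') = (0, fun _ => 0) := hinj (Finset.mem_univ _) (Finset.mem_univ _) h1
    refine ⟨η', ?_⟩
    rw [hye, show ((-1) ^ (s' : ℕ) * ∏ j, F j ^ ((e' j : ℕ)) : (𝓞 K)ˣ) = ρ (s', e') from rfl, he0]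
    simp [ρ]
  simp only [T, Finset.mem_insert, Finset.mem_singleton] at hxT
  rcases hxT with h | h | h | h
  · obtain ⟨η', hη'⟩ := hsq x h
    exact ⟨0, 0, η', by rw [hη']; simp⟩
  · obtain ⟨η', hη'⟩ := hsq (-1 * x) (by rw [hσmul, hσn, h]; decide)
    refine ⟨1, 0, η', ?_⟩
    simp only [Fin.val_one, Fin.val_zero, pow_one, pow_zero, mul_one]
    rw [← hη', ← mul_assoc]
    simp
  · obtain ⟨η', hη'⟩ := hsq (εU * x) (by rw [hσmul, hσε, h]; decide)
    refine ⟨0, 1, εU⁻¹ * η', ?_⟩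
    simp only [Fin.val_one, Fin.val_zero, pow_one, pow_zero, one_mul]
    rw [mul_pow, ← hη', inv_pow]
    group
  · obtain ⟨η', hη'⟩ := hsq (-1 * εU * x) (by rw [hσmul, hσmul, hσn, hσε, h]; decide)
    refine ⟨1, 1, εU⁻¹ * η', ?_⟩
    simp only [Fin.val_one, pow_one]
    rw [mul_pow, ← hη', inv_pow]
    simp only [neg_mul, mul_neg, neg_neg, one_mul]
    group

end CubicField14483

end Literature.NumberTheory.NumberFields

end
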